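import Literature.NumberTheory.Transcendental.TorusZeroEstimate
import Mathlib.RingTheory.RootsOfUnity.Basic
import Mathlib.RingTheory.Noetherian.Basic
import Mathlib.Data.Fintype.Pi
import Mathlib.Analysis.Complex.Polynomial.Basic
import HarnessLib

/-!
# Saturation of a character lattice: `H_B` is a finite union of cosets of the subtorus `H_A`

Topic: `Literature/NumberTheory/Transcendental` (support for `Philippon1986_zeroEstimate_torus_holds`).
For a subgroup `B ≤ ℤ^d` of characters of `T = (ℂˣ)^d` let `A = {a | k·a ∈ B for some k ≠ 0}` be
its saturation. Then `A` is a saturated subgroup containing `B` (so `H_A ≤ H_B`,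
`Torus.subtorus`), and **the image of `H_B` in `T/H_A` is finite** (`exists_saturation`): `A` is
finitely generated, a generator `a_j` has `k_j a_j ∈ B`, so `χ_{a_j}` takes values in the `k_j`-th
roots of unity on `H_B`, and two points of `H_B` with the same values of the `χ_{a_j}` are congruent
modulo `H_A`. This is the statement "`H_A` is the connected component of the identity of the
algebraic subgroup `H_B`, of finite index" of Nesterenko–Philippon (eds.), LNM 1752, Ch. 11 §2.1
Example ("`H_A` is connected iff `A` is saturated"), in the elementary form used by the zero
estimate.

## References

* Yu. V. Nesterenko, P. Philippon (eds.), *Introduction to Algebraic Independence Theory*,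
  LNM 1752 (2001), Ch. 11 (D. Roy), §2.1, Example (p. 199). [NesterenkoPhilippon2001]
-/

noncomputable section

namespace Literature.NumberTheory.Transcendental

open Torus

variable {d : ℕ}

/-- `χ_{a+b} = χ_a χ_b`. [folklore] -/
theorem char_add (a b : Fin d → ℤ) (g : Torus d) : char (a + b) g = char a g * char b g := by
  simp only [char_apply, Pi.add_apply, zpow_add, Finset.prod_mul_distrib]

/-- `χ_0 = 1`. [folklore] -/
theorem char_zero (g : Torus d) : char (0 : Fin d → ℤ) g = 1 := by simp [char_apply]

/-- `χ_{-a} = χ_a⁻¹`. [folklore] -/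
theorem char_neg (a : Fin d → ℤ) (g : Torus d) : char (-a) g = (char a g)⁻¹ := by
  simp only [char_apply, Pi.neg_apply, zpow_neg, Finset.prod_inv_distrib]

/-- `χ_{k•a} = χ_a^k`. [folklore] -/
theorem char_zsmul (k : ℤ) (a : Fin d → ℤ) (g : Torus d) : char (k • a) g = (char a g) ^ k := by
  simp only [char_apply, Pi.smul_apply, smul_eq_mul, ← Finset.prod_zpow]
  refine Finset.prod_congr rfl fun i _ => ?_
  rw [mul_comm, zpow_mul]

/-- The characters trivial at a point form a subgroup of `ℤ^d`; hence if they contain a generating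
set of `A` they contain `A`. [folklore] -/
theorem forall_char_eq_one_of_closure {G : Set (Fin d → ℤ)} {w : Torus d}
    (h : ∀ a ∈ G, char a w = 1) : ∀ a ∈ AddSubgroup.closure G, char a w = 1 := by
  intro a ha
  induction ha using AddSubgroup.closure_induction with
  | mem x hx => exact h x hx
  | zero => exact char_zero w
  | add x y _ _ hx hy => rw [char_add, hx, hy, one_mul]
  | neg x _ hx => rw [char_neg, hx, inv_one]

/-- **Saturation**: for `B ≤ ℤ^d` there is a saturated subgroup `A ⊇ B` (namely
`A = {a | ∃ k ≠ 0, k • a ∈ B}`) such that the image of `H_B` in `T / H_A` is finite.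
[cite: NesterenkoPhilippon2001, Ch. 11 §2.1 Example p. 199] -/
theorem exists_saturation (B : AddSubgroup (Fin d → ℤ)) :
    ∃ A : AddSubgroup (Fin d → ℤ), B ≤ A ∧
      (∀ (k : ℤ) (χ : Fin d → ℤ), k ≠ 0 → k • χ ∈ A → χ ∈ A) ∧
      ((QuotientGroup.mk : Torus d → Torus d ⧸ subtorus A) '' (subtorus B : Set (Torus d))).Finite := by
  classical
  let A : AddSubgroup (Fin d → ℤ) :=
    { carrier := {a | ∃ k : ℤ, k ≠ 0 ∧ k • a ∈ B}
      zero_mem' := ⟨1, one_ne_zero, by rw [smul_zero]; exact B.zero_mem⟩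
      add_mem' := by
        rintro a b ⟨k, hk, hka⟩ ⟨l, hl, hlb⟩
        refine ⟨k * l, mul_ne_zero hk hl, ?_⟩
        rw [smul_add, mul_comm k l, mul_smul, mul_smul, smul_comm l k b]
        exact B.add_mem (B.zsmul_mem hka l) (B.zsmul_mem hlb k)
      neg_mem' := by
        rintro a ⟨k, hk, hka⟩
        exact ⟨k, hk, by rw [smul_neg]; exact B.neg_mem hka⟩ }
  have hmemA : ∀ a, a ∈ A ↔ ∃ k : ℤ, k ≠ 0 ∧ k • a ∈ B := fun a => Iff.rfl
  have hBA : B ≤ A := fun a ha => ⟨1, one_ne_zero, by rwa [one_smul]⟩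
  have hsat : ∀ (k : ℤ) (χ : Fin d → ℤ), k ≠ 0 → k • χ ∈ A → χ ∈ A := by
    rintro k χ hk ⟨l, hl, hlk⟩
    exact ⟨l * k, mul_ne_zero hl hk, by rwa [mul_smul]⟩
  refine ⟨A, hBA, hsat, ?_⟩
  -- generators of `A` and their exponents
  have hfg : (A.toIntSubmodule).FG := Submodule.FG.of_le_of_isNoetherian (T := ⊤) le_top
  obtain ⟨G, hG⟩ := hfg
  have hGmem : ∀ a ∈ G, ∃ k : ℤ, k ≠ 0 ∧ k • a ∈ B := fun a ha => by
    have : a ∈ A.toIntSubmodule := hG ▸ Submodule.subset_span ha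
    exact (hmemA a).mp this
  choose k hk hkB using hGmem
  -- `χ_a`, `a ∈ G`, takes values in the `|k_a|`-th roots of unity on `H_B`
  let φ : Torus d → (↥G → ℂˣ) := fun z a => char (a : Fin d → ℤ) z
  have hroots : ∀ z ∈ (subtorus B : Set (Torus d)), ∀ a : ↥G,
      φ z a ∈ (rootsOfUnity (k a.1 a.2).natAbs ℂ : Set ℂˣ) := by
    intro z hz a
    change char (a : Fin d → ℤ) z ∈ (rootsOfUnity (k a.1 a.2).natAbs ℂ : Set ℂˣ)
    rw [SetLike.mem_coe, mem_rootsOfUnity]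
    have h1 : char (k a.1 a.2 • (a : Fin d → ℤ)) z = 1 := (mem_subtorus.mp hz) _ (hkB a.1 a.2)
    rw [char_zsmul] at h1
    rcases Int.natAbs_eq (k a.1 a.2) with hk' | hk'
    · rw [hk', zpow_natCast] at h1; exact h1
    · rw [hk', zpow_neg, zpow_natCast, inv_eq_one] at h1; exact h1
  have hRfin : (Set.pi Set.univ fun a : ↥G => (rootsOfUnity (k a.1 a.2).natAbs ℂ : Set ℂˣ)).Finite := by
    refine Set.Finite.pi fun a => ?_
    haveI : NeZero (k a.1 a.2).natAbs := ⟨Int.natAbs_ne_zero.mpr (hk a.1 a.2)⟩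
    exact Set.finite_coe_iff.mp (inferInstanceAs (Finite (rootsOfUnity (k a.1 a.2).natAbs ℂ)))
  -- points of `H_B` with the same `φ` are congruent modulo `H_A`
  have hcongr : ∀ z ∈ (subtorus B : Set (Torus d)), ∀ z' ∈ (subtorus B : Set (Torus d)),
      φ z = φ z' → (QuotientGroup.mk z : Torus d ⧸ subtorus A) = QuotientGroup.mk z' := by
    intro z _ z' _ hφ
    apply QuotientGroup.eq.mpr
    rw [mem_subtorus]
    have hgen : ∀ a ∈ (G : Set (Fin d → ℤ)), char a (z⁻¹ * z') = 1 := by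
      intro a ha
      have := congr_fun hφ ⟨a, ha⟩
      change char a z = char a z' at this
      rw [map_mul, map_inv, this, inv_mul_cancel]
    have hcl := forall_char_eq_one_of_closure hgen
    have hclos : AddSubgroup.closure (G : Set (Fin d → ℤ)) = A := by
      rw [← Submodule.span_int_eq_addSubgroupClosure, hG, AddSubgroup.toIntSubmodule_toAddSubgroup]
    intro a ha
    rw [← hclos] at ha
    exact hcl a ha
  -- a section of `φ` on its image
  let ψ : (↥G → ℂˣ) → Torus d ⧸ subtorus A := fun u =>
    if h : ∃ z ∈ (subtorus B : Set (Torus d)), φ z = u then QuotientGroup.mk h.choose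
    else QuotientGroup.mk 1
  refine (hRfin.image ψ).subset ?_
  rintro _ ⟨z, hz, rfl⟩
  refine ⟨φ z, Set.mem_univ_pi.mpr (hroots z hz), ?_⟩
  have hex : ∃ z' ∈ (subtorus B : Set (Torus d)), φ z' = φ z := ⟨z, hz, rfl⟩
  change (if h : ∃ z' ∈ (subtorus B : Set (Torus d)), φ z' = φ z then QuotientGroup.mk h.choose
    else QuotientGroup.mk 1) = QuotientGroup.mk z
  rw [dif_pos hex]
  exact hcongr _ hex.choose_spec.1 _ hz hex.choose_spec.2

end Literature.NumberTheory.Transcendental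

end
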